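import Summits.ValiantsHypothesis.ValiantsHypothesis.Theorems.LacunarySymmetroidMatrixDescartesCensusSignClass
import Literature.Analysis.TotalPositivity.GeneralizedVandermonde

/-!
# `MatrixDescartes` census — ROOT-SIDE PARAMETRIZATION of Descartes-sharp `2 × 2` pencil determinants (kernel schema)

HONEST FRAMING.  Object-search cell `pub-symmetroid`, route crux `Theses.LacunarySymmetroid.MatrixDescartes`
(ledger item stmt-ValiantsHypothesis-18050).  The cell's V = 20 programme for the typed target
`DoorA26 = PosRootLawAt 2 6 19` (OPEN, never asserted) has a ROOT-SIDE branch (theory CONJECTURE.md §5 P5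
«Schur certificates»; engine-5 g14 `E5G14-RANK3.md` §4b, statement of record «M4-POS(d)», lead R1131): a
HYPOTHETICAL twenty on a 2-Sidon support `d` is Descartes-sharp on the 21 pair sums `E₀ < ⋯ < E₂₀`, so its
coefficient vector is `λ · c(ρ)`, `c_u(ρ) = (−1)^u det (ρ_i^{E_v})_{v ≠ u}` the alternating signed generalized-
Vandermonde minors of its 20 positive roots `ρ` — and every polynomial identity the Gram dictionary forces on the
coefficients (rank `≤ 3` of six vectors in `Sym₂(ℝ) ≅ ℝ^{1,2}`: all `4 × 4` minors vanish,
`Census.gram_det_four_eq_zero`, `Census.gram_det_cross_four_eq_zero`) becomes an identity `Φ(c(ρ)) = 0` on the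
root side; a support on which some such `Φ` never vanishes carries no twenty.  The ANALYTIC half of this
(«generalised-Vandermonde kernel = bialternant vector», recorded as NOT formalised in `…CensusGram.lean`) is now
the Literature file `Literature.Analysis.TotalPositivity.GeneralizedVandermonde` (Gantmacher Vol. 2 XIII §8
Example 1; Pinkus 1985 III §1 Prop. 1.3).  This file is the pencil-side glue, for every `K`:

* `support_det_pencil_two_subset_image` — if every pair sum `d a + d b` is among the values of
  `E : Fin (n+1) → ℕ`, the support of `det F` lies in the image of `E` (dictionary F0, `coeff_det_pencil_two`);
* `exists_roots_coeff_det_eq_mul_signedMinor` — **root-side parametrization**: if moreover `E` is sorted and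
  `det F` has at least `n ≥ 1` distinct positive roots, there are sorted positive roots `ρ₀ < ⋯ < ρ_{n−1}` and
  `t ≠ 0` with `coeff (det F) (E u) = t · c_u(ρ)` for all `u`;
* `card_posRoots_det_le_of_rootSide` — **the schema**: if a function `Φ` of the `n + 1` coefficients vanishes on
  the coefficient vector of `det F` for every symmetric `S` (a Gram identity) but never on a vector `t · c(ρ)`
  (`t ≠ 0`, `ρ` sorted positive), then `#Z₊(det F) ≤ n − 1` on `d`; `card_posRoots_le_19_of_rootSide` is the
  `(2,6)` / `n = 20` instance in the unfolded form of the cell's table rows `PosRootLawOn 2 6 19 d`;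
* `card_posRoots_det_le_of_rootSide_of_sign` — the INEQUALITY form of the schema, cell by cell: `0 ≤ Φ` on every
  symmetric pencil's coefficients (a Gram inequality: `G3 ≥ 0`, reverse Cauchy–Schwarz, …) and `Φ(t · c(ρ)) < 0`
  whenever `0 < s · t` ⇒ `#Z₊ ≤ n − 1` on the cell «lowest coefficient of sign `s`»;
* `gramHat_entry_of_sidon` — on a 2-Sidon support the would-be Gram matrix
  `Ĝ_ij = (2 if i = j else 1) · coeff (det F) (d i + d j)` is `2·Gram_B(S)` (the vanishing of its `4 × 4` minors
  and **the M4 consumer** `card_posRoots_le_19_of_minor_four_ne_zero` — «M4-POS(d) ⇒ NO TWENTY on `d`» — live in the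
  companion file `…CensusRootSideM4.lean`, which adds the import `…CensusGramCross`);
* `le_card_posRoots_det_of_coeff_eq_mul_signedMinor` — the CONVERSE (coefficients `t · c(ρ)` ⇒ the `ρ_i` are roots,
  `#Z₊ ≥ n`): the root-side chart «twenty on `d` ⟺ Gram image meets the cone `{t · c(ρ)}`» is exact.

Nothing here is specific to one support, asserts `M4-POS`, or bears on `DoorA26` as a format-level statement, on
the crux `MatrixDescartes`, or on `VP ≠ VNP`.  [folklore] Linear algebra over the Literature facts cited above.
-/

-- `Summit.ValiantsHypothesis.ValiantsHypothesis.…` repeats a component by the D-0017 layout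
-- (single-conjunct summit), which the `dupNamespace` linter flags; the name is mandated.
set_option linter.dupNamespace false

namespace Summit.ValiantsHypothesis.ValiantsHypothesis.Theorems.LacunarySymmetroidMatrixDescartes.Census

open Polynomial Finset
open scoped BigOperators Polynomial Matrix
open Literature.Analysis.TotalPositivity (maximalMinor_pos exists_roots_coeff_eq_mul_signedMinor)

/-- If every pair sum `d a + d b` of the exponent vector is a value of `E`, the determinant of a `2 × 2` pencil on
`d` is supported on the image of `E` (dictionary F0: each coefficient of `det F` is a sum over the pairs with that
pair sum). [folklore] -/
theorem support_det_pencil_two_subset_image {K n : ℕ} (d : Fin K → ℕ) (S : Fin K → Matrix (Fin 2) (Fin 2) ℝ)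
    (E : Fin (n + 1) → ℕ) (hWE : ∀ p : Fin K × Fin K, d p.1 + d p.2 ∈ Finset.univ.image E) :
    (∑ l, ((X : ℝ[X]) ^ d l) • (S l).map C).det.support ⊆ Finset.univ.image E := by
  intro k hk
  rw [mem_support_iff, coeff_det_pencil_two] at hk
  obtain ⟨p, hp, -⟩ := Finset.exists_ne_zero_of_sum_ne_zero hk
  rw [Finset.mem_filter] at hp
  rw [← hp.2]
  exact hWE p

/-- **Root-side parametrization of a Descartes-sharp `2 × 2` pencil determinant.**  Let `F = ∑ l, X^{d l} • S l`
(`S l` real `2 × 2`, symmetric or not), let the sorted exponents `E₀ < ⋯ < E_n` contain every pair sum of `d`, and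
suppose `det F` has at least `n ≥ 1` distinct positive roots (on a 2-Sidon six-support with `n = 20`: a
hypothetical TWENTY).  Then there are sorted positive roots `ρ₀ < ⋯ < ρ_{n−1}` of `det F` and a real `t ≠ 0` with
`coeff (det F) (E u) = t · (−1)^u · det (ρ_i ^ {E_v})_{v ≠ u}` for every `u` — the coefficient vector is a non-zero
multiple of the strictly alternating signed-minor vector `c(ρ)` (`Literature…maximalMinor_pos`).
[folklore] (Pinkus 1985 III Prop. 1.3 / Gantmacher XIII §8 Ex. 1, via the Literature file) -/
theorem exists_roots_coeff_det_eq_mul_signedMinor {K n : ℕ} (d : Fin K → ℕ)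
    (S : Fin K → Matrix (Fin 2) (Fin 2) ℝ) (E : Fin (n + 1) → ℕ) (hE : StrictMono E)
    (hWE : ∀ p : Fin K × Fin K, d p.1 + d p.2 ∈ Finset.univ.image E) (hn : 0 < n)
    (hZ : n ≤ ((∑ l, ((X : ℝ[X]) ^ d l) • (S l).map C).det.roots.toFinset.filter (fun t => 0 < t)).card) :
    ∃ ρ : Fin n → ℝ, (∀ i, 0 < ρ i) ∧ StrictMono ρ ∧
      (∀ i, (∑ l, ((X : ℝ[X]) ^ d l) • (S l).map C).det.IsRoot (ρ i)) ∧
      ∃ t : ℝ, t ≠ 0 ∧ ∀ u, (∑ l, ((X : ℝ[X]) ^ d l) • (S l).map C).det.coeff (E u) =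
        t * ((-1 : ℝ) ^ (u : ℕ) * (Matrix.of fun i v => ρ i ^ E (u.succAbove v)).det) := by
  have hf : (∑ l, ((X : ℝ[X]) ^ d l) • (S l).map C).det ≠ 0 := by
    intro h
    rw [h, roots_zero, Multiset.toFinset_zero, Finset.filter_empty, Finset.card_empty] at hZ
    omega
  exact exists_roots_coeff_eq_mul_signedMinor _ hf E hE (support_det_pencil_two_subset_image d S E hWE) hZ

/-- **The root-side certificate schema (any `K`).**  Let the sorted exponents `E₀ < ⋯ < E_n` (`n ≥ 1`) contain
every pair sum of `d`, and let `Φ` be a real function of `n + 1` real arguments such that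
(i) `Φ` vanishes on the coefficient vector `u ↦ coeff (det F) (E u)` of EVERY real symmetric `2 × 2` pencil `F` on
`d` (a GRAM IDENTITY — e.g. a `4 × 4` minor of the would-be Gram matrix, `gram_det_cross_four_eq_zero`, read
through the dictionary `coeff_det_pencil_two_diag` / `_pair`), and (ii) `Φ (t · c(ρ)) ≠ 0` for every `t ≠ 0` and
all sorted positive `ρ` (a ROOT-SIDE POSITIVITY statement such as engine-5's «M4-POS(d)»).  Then every real
symmetric `2 × 2` pencil on `d` has at most `n − 1` distinct positive determinant roots. [folklore] -/
theorem card_posRoots_det_le_of_rootSide {K n : ℕ} (d : Fin K → ℕ) (E : Fin (n + 1) → ℕ) (hE : StrictMono E)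
    (hWE : ∀ p : Fin K × Fin K, d p.1 + d p.2 ∈ Finset.univ.image E) (hn : 0 < n)
    (Φ : (Fin (n + 1) → ℝ) → ℝ)
    (hΦS : ∀ S : Fin K → Matrix (Fin 2) (Fin 2) ℝ, (∀ l, (S l).IsSymm) →
      Φ (fun u => (∑ l, ((X : ℝ[X]) ^ d l) • (S l).map C).det.coeff (E u)) = 0)
    (hΦρ : ∀ ρ : Fin n → ℝ, (∀ i, 0 < ρ i) → StrictMono ρ → ∀ t : ℝ, t ≠ 0 →
      Φ (fun u => t * ((-1 : ℝ) ^ (u : ℕ) * (Matrix.of fun i v => ρ i ^ E (u.succAbove v)).det)) ≠ 0)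
    (S : Fin K → Matrix (Fin 2) (Fin 2) ℝ) (hS : ∀ l, (S l).IsSymm) :
    ((∑ l, ((X : ℝ[X]) ^ d l) • (S l).map C).det.roots.toFinset.filter (fun t => 0 < t)).card ≤ n - 1 := by
  by_contra hlt
  have hZ : n ≤ ((∑ l, ((X : ℝ[X]) ^ d l) • (S l).map C).det.roots.toFinset.filter
      (fun t => 0 < t)).card := by omega
  obtain ⟨ρ, hρ0, hρ, -, t, ht, hcoeff⟩ := exists_roots_coeff_det_eq_mul_signedMinor d S E hE hWE hn hZ
  have h1 := hΦS S hS
  have h2 := hΦρ ρ hρ0 hρ t ht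
  have h3 : (fun u : Fin (n + 1) => (∑ l, ((X : ℝ[X]) ^ d l) • (S l).map C).det.coeff (E u)) =
      (fun u : Fin (n + 1) =>
        t * ((-1 : ℝ) ^ (u : ℕ) * (Matrix.of fun i v => ρ i ^ E (u.succAbove v)).det)) :=
    funext hcoeff
  rw [h3] at h1
  exact h2 h1

/-- **The `(2,6)` instance of the schema, in the form of the cell's table rows** (`PosRootLawOn 2 6 19 d`
unfolded): a six-term exponent vector `d` whose pair sums lie among sorted `E₀ < ⋯ < E₂₀`, a Gram identity `Φ`
on the 21 determinant coefficients of every real symmetric `2 × 2` pencil on `d`, and root-side non-vanishing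
`Φ (t · c(ρ)) ≠ 0` (`t ≠ 0`, `0 < ρ₀ < ⋯ < ρ₁₉`) give `#Z₊(det F) ≤ 19` for every such pencil: NO TWENTY on `d`.
(For a 2-Sidon `d` the 21 pair sums are distinct and `E` is their increasing enumeration; `hWE` is then decidable
support data.)  A typed `M4Pos_…` statement (typer, R1131/R1157) is consumed by this lemma in one line.
[folklore] -/
theorem card_posRoots_le_19_of_rootSide (d : Fin 6 → ℕ) (E : Fin 21 → ℕ) (hE : StrictMono E)
    (hWE : ∀ p : Fin 6 × Fin 6, d p.1 + d p.2 ∈ Finset.univ.image E)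
    (Φ : (Fin 21 → ℝ) → ℝ)
    (hΦS : ∀ S : Fin 6 → Matrix (Fin 2) (Fin 2) ℝ, (∀ l, (S l).IsSymm) →
      Φ (fun u => (∑ l, ((X : ℝ[X]) ^ d l) • (S l).map C).det.coeff (E u)) = 0)
    (hΦρ : ∀ ρ : Fin 20 → ℝ, (∀ i, 0 < ρ i) → StrictMono ρ → ∀ t : ℝ, t ≠ 0 →
      Φ (fun u => t * ((-1 : ℝ) ^ (u : ℕ) * (Matrix.of fun i v => ρ i ^ E (u.succAbove v)).det)) ≠ 0)
    (S : Fin 6 → Matrix (Fin 2) (Fin 2) ℝ) (hS : ∀ l, (S l).IsSymm) :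
    ((∑ l, ((X : ℝ[X]) ^ d l) • (S l).map C).det.roots.toFinset.filter (fun t => 0 < t)).card ≤ 19 :=
  card_posRoots_det_le_of_rootSide d E hE hWE (by norm_num) Φ hΦS hΦρ S hS

/-- **Root-side strict alternation for pencils** (the kernel form of «`c_t(ρ)` alternating by total positivity»,
R1131): in the situation of `exists_roots_coeff_det_eq_mul_signedMinor`, any two coefficients of `det F` on the
knots `E u`, `E v` satisfy `0 < (−1)^{u+v} · coeff (E u) · coeff (E v)` — all 21 knots of a hypothetical twenty
carry non-zero coefficients with signs `s · (−1)^u` (this is F1 `pow_rank_mul_coeff_mul_coeff_pos_of_sharp` again,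
reached from the root side). [folklore] -/
theorem pow_mul_coeff_det_mul_coeff_det_pos {K n : ℕ} (d : Fin K → ℕ)
    (S : Fin K → Matrix (Fin 2) (Fin 2) ℝ) (E : Fin (n + 1) → ℕ) (hE : StrictMono E)
    (hWE : ∀ p : Fin K × Fin K, d p.1 + d p.2 ∈ Finset.univ.image E) (hn : 0 < n)
    (hZ : n ≤ ((∑ l, ((X : ℝ[X]) ^ d l) • (S l).map C).det.roots.toFinset.filter (fun t => 0 < t)).card)
    (u v : Fin (n + 1)) :
    0 < (-1 : ℝ) ^ ((u : ℕ) + (v : ℕ)) *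
      ((∑ l, ((X : ℝ[X]) ^ d l) • (S l).map C).det.coeff (E u) *
        (∑ l, ((X : ℝ[X]) ^ d l) • (S l).map C).det.coeff (E v)) := by
  have hf : (∑ l, ((X : ℝ[X]) ^ d l) • (S l).map C).det ≠ 0 := by
    intro h
    rw [h, roots_zero, Multiset.toFinset_zero, Finset.filter_empty, Finset.card_empty] at hZ
    omega
  exact Literature.Analysis.TotalPositivity.pow_mul_coeff_mul_coeff_pos_of_card_roots _ hf E hE
    (support_det_pencil_two_subset_image d S E hWE) hZ u v

/-- **The root-side schema, INEQUALITY form (orientation-aware).**  Same setting; now `Φ` is only known to be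
NON-NEGATIVE on the coefficient vector of every real symmetric `2 × 2` pencil on `d` (a Gram INEQUALITY — e.g. a
`3 × 3` principal Gram minor `G3 ≥ 0` of the Lorentz form, `Census.g3_nonneg`, or a reverse Cauchy–Schwarz row),
and NEGATIVE on every root-side vector `t · c(ρ)` whose scalar has the sign `s` of the cell (`0 < s · t`).  Then no
pencil on `d` whose lowest coefficient `coeff (det F) (E 0)` has sign `s` (`0 < s · coeff`) has `n` distinct
positive determinant roots: `#Z₊(det F) ≤ n − 1` on the cell `(d, s)`.  (Root side, `c₀(ρ) > 0`, so the sign of `t`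
IS the sign of the lowest coefficient.) [folklore] -/
theorem card_posRoots_det_le_of_rootSide_of_sign {K n : ℕ} (d : Fin K → ℕ) (E : Fin (n + 1) → ℕ)
    (hE : StrictMono E) (hWE : ∀ p : Fin K × Fin K, d p.1 + d p.2 ∈ Finset.univ.image E) (hn : 0 < n)
    (s : ℝ) (Φ : (Fin (n + 1) → ℝ) → ℝ)
    (hΦS : ∀ S : Fin K → Matrix (Fin 2) (Fin 2) ℝ, (∀ l, (S l).IsSymm) →
      0 ≤ Φ (fun u => (∑ l, ((X : ℝ[X]) ^ d l) • (S l).map C).det.coeff (E u)))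
    (hΦρ : ∀ ρ : Fin n → ℝ, (∀ i, 0 < ρ i) → StrictMono ρ → ∀ t : ℝ, 0 < s * t →
      Φ (fun u => t * ((-1 : ℝ) ^ (u : ℕ) * (Matrix.of fun i v => ρ i ^ E (u.succAbove v)).det)) < 0)
    (S : Fin K → Matrix (Fin 2) (Fin 2) ℝ) (hS : ∀ l, (S l).IsSymm)
    (hsign : 0 < s * (∑ l, ((X : ℝ[X]) ^ d l) • (S l).map C).det.coeff (E 0)) :
    ((∑ l, ((X : ℝ[X]) ^ d l) • (S l).map C).det.roots.toFinset.filter (fun t => 0 < t)).card ≤ n - 1 := by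
  by_contra hlt
  have hZ : n ≤ ((∑ l, ((X : ℝ[X]) ^ d l) • (S l).map C).det.roots.toFinset.filter
      (fun t => 0 < t)).card := by omega
  obtain ⟨ρ, hρ0, hρ, -, t, -, hcoeff⟩ := exists_roots_coeff_det_eq_mul_signedMinor d S E hE hWE hn hZ
  -- the sign of `t` is the sign of the lowest coefficient, since `c₀(ρ) > 0`
  have hc0 : 0 < (Matrix.of fun i v => ρ i ^ E ((0 : Fin (n + 1)).succAbove v)).det :=
    maximalMinor_pos ρ E hρ0 hρ hE 0
  have hst : 0 < s * t := by
    have h0 := hcoeff 0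
    rw [Fin.val_zero, pow_zero, one_mul] at h0
    rw [h0, ← mul_assoc] at hsign
    exact (mul_pos_iff_of_pos_right hc0).mp hsign
  have h1 := hΦS S hS
  have h2 := hΦρ ρ hρ0 hρ t hst
  have h3 : (fun u : Fin (n + 1) => (∑ l, ((X : ℝ[X]) ^ d l) • (S l).map C).det.coeff (E u)) =
      (fun u : Fin (n + 1) =>
        t * ((-1 : ℝ) ^ (u : ℕ) * (Matrix.of fun i v => ρ i ^ E (u.succAbove v)).det)) :=
    funext hcoeff
  rw [h3] at h1
  exact (not_lt.mpr h1) h2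

/-! ### The would-be Gram matrix read off the coefficients (2-Sidon supports) and the `4 × 4`-minor consumer -/

/-- On a 2-Sidon exponent vector (all pair sums `d a + d b`, `a ≤ b`, distinct) the «would-be Gram entry» read off
the determinant coefficients — `Ĝ_ij := (2 if i = j, else 1) · coeff (det F) (d i + d j)` — equals the polarised
determinant form `S i ₀₀ S j ₁₁ + S i ₁₁ S j ₀₀ − 2 S i ₀₁ S j ₀₁` for SYMMETRIC `2 × 2` letters (dictionary F0:
`c_{2dᵢ} = det Sᵢ`, `c_{dᵢ+dⱼ} = 2B(Sᵢ,Sⱼ)`; so `Ĝ = 2·Gram_B`). [folklore] -/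
theorem gramHat_entry_of_sidon {K : ℕ} (d : Fin K → ℕ)
    (hSidon : ∀ p q : Fin K × Fin K, d p.1 + d p.2 = d q.1 + d q.2 → p = q ∨ p = q.swap)
    (S : Fin K → Matrix (Fin 2) (Fin 2) ℝ) (hS : ∀ l, (S l).IsSymm) (i j : Fin K) :
    (if i = j then (2 : ℝ) else 1) * (∑ l, ((X : ℝ[X]) ^ d l) • (S l).map C).det.coeff (d i + d j) =
      S i 0 0 * S j 1 1 + S i 1 1 * S j 0 0 - 2 * (S i 0 1 * S j 0 1) := by
  have hsym : ∀ l, S l 1 0 = S l 0 1 := fun l => by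
    simpa using congrFun (congrFun (hS l) 0) 1
  by_cases hij : i = j
  · subst hij
    rw [if_pos rfl, coeff_det_pencil_two_diag d S i (fun p hp => ?_)]
    · rw [hsym i]; ring
    · rcases hSidon p (i, i) hp with h | h
      · exact h
      · rw [h]; rfl
  · rw [if_neg hij, one_mul, coeff_det_pencil_two_pair d S hij (fun p hp => ?_)]
    · rw [hsym i, hsym j]; ring
    · rcases hSidon p (i, j) hp with h | h
      · exact Or.inl h
      · exact Or.inr (by rw [h]; rfl)

/-! ### The converse: prescribed roots are roots (the root-side chart loses nothing) -/

/-- Evaluation of a `2 × 2` pencil determinant whose pair sums lie among the values of an injective `E` as the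
fewnomial sum `Σ_u coeff (E u) · y^{E u}`. [folklore] -/
theorem eval_det_pencil_two_eq_sum {K n : ℕ} (d : Fin K → ℕ) (S : Fin K → Matrix (Fin 2) (Fin 2) ℝ)
    (E : Fin (n + 1) → ℕ) (hE : Function.Injective E)
    (hWE : ∀ p : Fin K × Fin K, d p.1 + d p.2 ∈ Finset.univ.image E) (y : ℝ) :
    (∑ l, ((X : ℝ[X]) ^ d l) • (S l).map C).det.eval y =
      ∑ u : Fin (n + 1), (∑ l, ((X : ℝ[X]) ^ d l) • (S l).map C).det.coeff (E u) * y ^ E u := by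
  classical
  have hsupp := support_det_pencil_two_subset_image d S E hWE
  rw [eval_eq_sum, sum_def, Finset.sum_subset hsupp (fun k _ hk => by rw [notMem_support_iff.mp hk, zero_mul]),
    Finset.sum_image (fun a _ b _ h => hE h)]

/-- **Converse of the parametrization.**  If the determinant coefficients of a `2 × 2` pencil on `d` (pair sums
among sorted `E₀ < ⋯ < E_n`) ARE `t · c(ρ)` for some `t ≠ 0` and sorted positive `ρ₀ < ⋯ < ρ_{n−1}`, then every
`ρ_i` is a root of `det F ≠ 0`, so `det F` has at least `n` distinct positive roots.  Together with
`exists_roots_coeff_det_eq_mul_signedMinor`: «a twenty on `d`» ⟺ «the Gram image meets the cone `{t · c(ρ)}`» —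
the root-side chart of the cell's V = 20 problem is exact. [folklore] -/
theorem le_card_posRoots_det_of_coeff_eq_mul_signedMinor {K n : ℕ} (d : Fin K → ℕ)
    (S : Fin K → Matrix (Fin 2) (Fin 2) ℝ) (E : Fin (n + 1) → ℕ) (hE : StrictMono E)
    (hWE : ∀ p : Fin K × Fin K, d p.1 + d p.2 ∈ Finset.univ.image E)
    (ρ : Fin n → ℝ) (hρ0 : ∀ i, 0 < ρ i) (hρ : StrictMono ρ) (t : ℝ) (ht : t ≠ 0)
    (hcoeff : ∀ u, (∑ l, ((X : ℝ[X]) ^ d l) • (S l).map C).det.coeff (E u) =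
      t * ((-1 : ℝ) ^ (u : ℕ) * (Matrix.of fun i v => ρ i ^ E (u.succAbove v)).det)) :
    n ≤ ((∑ l, ((X : ℝ[X]) ^ d l) • (S l).map C).det.roots.toFinset.filter (fun t => 0 < t)).card := by
  classical
  set f := (∑ l, ((X : ℝ[X]) ^ d l) • (S l).map C).det with hf
  have hf0 : f ≠ 0 := by
    intro h
    have h0 := hcoeff 0
    rw [h, coeff_zero, Fin.val_zero, pow_zero, one_mul] at h0
    exact (mul_ne_zero ht (maximalMinor_pos ρ E hρ0 hρ hE 0).ne') h0.symm
  have hroot : ∀ i, f.IsRoot (ρ i) := by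
    intro i
    rw [IsRoot, hf, eval_det_pencil_two_eq_sum d S E hE.injective hWE]
    have h := Literature.Analysis.TotalPositivity.sum_pow_mul_signedMinor_eq_zero ρ E i
    calc ∑ u : Fin (n + 1), (∑ l, ((X : ℝ[X]) ^ d l) • (S l).map C).det.coeff (E u) * ρ i ^ E u
        = t * ∑ u : Fin (n + 1), ρ i ^ E u *
            ((-1 : ℝ) ^ (u : ℕ) * (Matrix.of fun i v => ρ i ^ E (u.succAbove v)).det) := by
          rw [Finset.mul_sum]
          exact Finset.sum_congr rfl fun u _ => by rw [← hf, hcoeff u]; ring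
      _ = 0 := by rw [h, mul_zero]
  have hsub : (Finset.univ : Finset (Fin n)).image ρ ⊆ f.roots.toFinset.filter (fun t => 0 < t) := by
    intro y hy
    obtain ⟨i, -, rfl⟩ := Finset.mem_image.mp hy
    exact Finset.mem_filter.mpr ⟨Multiset.mem_toFinset.mpr ((mem_roots hf0).mpr (hroot i)), hρ0 i⟩
  calc n = ((Finset.univ : Finset (Fin n)).image ρ).card := by
        rw [Finset.card_image_of_injective _ hρ.injective]; simp
    _ ≤ _ := Finset.card_le_card hsub

end Summit.ValiantsHypothesis.ValiantsHypothesis.Theorems.LacunarySymmetroidMatrixDescartes.Census
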